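import Mathlib

/-!
# T5CoshIntegral — the elementary integrals of T5-N4-p5 (N4.3.P1) and (N4.3.P2′)

Kernel form of the two one-variable integrals that the archimedean sub-step N4.3 of
Tier 5 (route/T5-N4-p5.md, owner p5) evaluates by hand:

* (N4.3.P2′): against Rühl's invariant measure `dμ = ½ sinh η dη (4π)⁻² dψ₁ dψ₂`
  (Rühl 1970, Appendix A-2f, p0147 ll. 14–22), the lowest-weight matrix coefficient
  `cosh(η/2)^(-3)` of the positive discrete series `(3/2, +)` satisfies
  `½ ∫₀^∞ cosh(η/2)^(-3p) sinh η dη = 2/(3p − 2)` — `= 2` for `p = 1` (the `L¹` norm)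
  and `= 1/2` for `p = 2` (the `L²` norm, the reciprocal formal degree `2k − 1 = 2`).
* (N4.3.P1), the bounce answer to ref-2 N-T5N4.1′: the dominating integral
  `∫₀^∞ cosh(t)^ε · cosh(t)^(-6) · sinh(2t) dt` is finite for `ε < 4`; its value is `2/(4 − ε)`.

Both are instances of one closed formula, `integral_sinh_mul_cosh_rpow`:
`∫₀^∞ sinh(aη) · cosh(aη)^(-(r+1)) dη = 1/(a r)` for `a, r > 0` (substitute `u = cosh(aη)`;
here proved by the fundamental theorem of calculus on `[0, ∞)` with the explicit
antiderivative `-(1/(a r)) cosh(aη)^(-r)`, no auxiliary definition). Everything is Mathlib-only; nothing here is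
about the representation `π₀,τ′_j` itself — the identification of the coefficient with
`cosh(η/2)^(-3)` is the mean-value computation of `T5MeanValue.lean`.
-/

namespace Summit.Ventures.HodgeRepro2.T5CoshIntegral

open Real MeasureTheory Set Filter Topology

/-- The antiderivative `η ↦ -(1/(a r)) · cosh(aη)^(-r)` of `sinh(aη) · cosh(aη)^(-(r+1))`
(for `a, r ≠ 0`). -/
lemma hasDerivAt_antideriv (a r : ℝ) (ha : a ≠ 0) (hr : r ≠ 0) (η : ℝ) :
    HasDerivAt (fun η : ℝ => -(1 / (a * r)) * Real.cosh (a * η) ^ (-r))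
      (Real.sinh (a * η) * Real.cosh (a * η) ^ (-(r + 1))) η := by
  have h1 : HasDerivAt (fun η : ℝ => a * η) a η := by
    simpa using (hasDerivAt_id η).const_mul a
  have h2 : HasDerivAt (fun η : ℝ => Real.cosh (a * η)) (Real.sinh (a * η) * a) η :=
    (Real.hasDerivAt_cosh (a * η)).comp η h1
  have hpos : Real.cosh (a * η) ≠ 0 := (Real.cosh_pos _).ne'
  have h3 : HasDerivAt (fun η : ℝ => Real.cosh (a * η) ^ (-r))
      (Real.sinh (a * η) * a * (-r) * Real.cosh (a * η) ^ (-r - 1)) η :=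
    h2.rpow_const (Or.inl hpos)
  have h4 : HasDerivAt (fun η : ℝ => -(1 / (a * r)) * Real.cosh (a * η) ^ (-r))
      (-(1 / (a * r)) * (Real.sinh (a * η) * a * (-r) * Real.cosh (a * η) ^ (-r - 1))) η :=
    h3.const_mul _
  have hexp : -(r + 1) = -r - 1 := by ring
  have heq : -(1 / (a * r)) * (Real.sinh (a * η) * a * (-r) * Real.cosh (a * η) ^ (-r - 1))
      = Real.sinh (a * η) * Real.cosh (a * η) ^ (-(r + 1)) := by
    rw [hexp]
    field_simp
  rw [← heq]
  exact h4

/-- `cosh x → ∞` as `x → ∞` (from `cosh x ≥ exp x / 2`). -/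
lemma tendsto_cosh_atTop : Tendsto Real.cosh atTop atTop := by
  have h1 : Tendsto (fun x : ℝ => Real.exp x / 2) atTop atTop :=
    Real.tendsto_exp_atTop.atTop_div_const (by norm_num)
  refine tendsto_atTop_mono (fun x => ?_) h1
  rw [Real.cosh_eq]
  have := Real.exp_pos (-x)
  linarith

/-- The antiderivative tends to `0` as `η → ∞` for `a, r > 0` (since `cosh(aη) → ∞` and
`x^(-r) → 0`). -/
lemma tendsto_antideriv (a r : ℝ) (ha : 0 < a) (hr : 0 < r) :
    Tendsto (fun η : ℝ => -(1 / (a * r)) * Real.cosh (a * η) ^ (-r)) atTop (𝓝 0) := by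
  have h1 : Tendsto (fun η : ℝ => a * η) atTop atTop :=
    Filter.Tendsto.const_mul_atTop ha tendsto_id
  have h2 : Tendsto (fun η : ℝ => Real.cosh (a * η)) atTop atTop :=
    tendsto_cosh_atTop.comp h1
  have h3 : Tendsto (fun η : ℝ => Real.cosh (a * η) ^ (-r)) atTop (𝓝 0) :=
    (tendsto_rpow_neg_atTop hr).comp h2
  have h4 : Tendsto (fun η : ℝ => -(1 / (a * r)) * Real.cosh (a * η) ^ (-r)) atTop
      (𝓝 (-(1 / (a * r)) * 0)) := h3.const_mul _
  rw [← mul_zero (-(1 / (a * r)))]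
  exact h4

/-- The integrand is non-negative on `(0, ∞)` for `a > 0`. -/
lemma integrand_nonneg (a r : ℝ) (ha : 0 < a) (η : ℝ) (hη : η ∈ Ioi (0 : ℝ)) :
    0 ≤ Real.sinh (a * η) * Real.cosh (a * η) ^ (-(r + 1)) := by
  have h1 : 0 ≤ Real.sinh (a * η) := by
    rw [Real.sinh_nonneg_iff]
    exact mul_nonneg ha.le (le_of_lt hη)
  exact mul_nonneg h1 (Real.rpow_pos_of_pos (Real.cosh_pos _) _).le

/-- **The closed formula.** For `a, r > 0`:
`∫₀^∞ sinh(aη) · cosh(aη)^(-(r+1)) dη = 1/(a r)`. -/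
theorem integral_sinh_mul_cosh_rpow (a r : ℝ) (ha : 0 < a) (hr : 0 < r) :
    ∫ η in Ioi (0 : ℝ), Real.sinh (a * η) * Real.cosh (a * η) ^ (-(r + 1)) = 1 / (a * r) := by
  have hcont : ContinuousWithinAt (fun η : ℝ => -(1 / (a * r)) * Real.cosh (a * η) ^ (-r))
      (Ici (0 : ℝ)) 0 :=
    (hasDerivAt_antideriv a r ha.ne' hr.ne' 0).continuousAt.continuousWithinAt
  have hderiv : ∀ η ∈ Ioi (0 : ℝ),
      HasDerivAt (fun η : ℝ => -(1 / (a * r)) * Real.cosh (a * η) ^ (-r))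
        (Real.sinh (a * η) * Real.cosh (a * η) ^ (-(r + 1))) η :=
    fun η _ => hasDerivAt_antideriv a r ha.ne' hr.ne' η
  rw [integral_Ioi_of_hasDerivAt_of_nonneg hcont hderiv (integrand_nonneg a r ha)
    (tendsto_antideriv a r ha hr)]
  simp

/-- **(N4.3.P2′), Rühl's measure.** For `p > 2/3`:
`½ ∫₀^∞ cosh(η/2)^(-3p) · sinh η dη = 2/(3p − 2)`.
(The factor `½ sinh η dη` is the `η`-part of Rühl's invariant measure (A-2f); the
`ψ`-integrations contribute the constant `(4π)⁻² · (4π)²` and are omitted.) -/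
theorem ruhl_measure_integral (p : ℝ) (hp : 2 / 3 < p) :
    ∫ η in Ioi (0 : ℝ), (1 / 2) * Real.sinh η * Real.cosh ((1 / 2) * η) ^ (-(3 * p))
      = 2 / (3 * p - 2) := by
  have hr : 0 < 3 * p - 2 := by linarith
  have ha : (0 : ℝ) < 1 / 2 := by norm_num
  have key := integral_sinh_mul_cosh_rpow (1 / 2) (3 * p - 2) ha hr
  have hfun : ∀ η : ℝ, (1 / 2) * Real.sinh η * Real.cosh ((1 / 2) * η) ^ (-(3 * p))
      = Real.sinh ((1 / 2) * η) * Real.cosh ((1 / 2) * η) ^ (-((3 * p - 2) + 1)) := by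
    intro η
    have hη : η = 2 * ((1 / 2) * η) := by ring
    have hs : Real.sinh η = 2 * Real.sinh ((1 / 2) * η) * Real.cosh ((1 / 2) * η) := by
      conv_lhs => rw [hη]
      exact Real.sinh_two_mul _
    have hc : 0 < Real.cosh ((1 / 2) * η) := Real.cosh_pos _
    have hpow : Real.cosh ((1 / 2) * η) * Real.cosh ((1 / 2) * η) ^ (-(3 * p))
        = Real.cosh ((1 / 2) * η) ^ (-((3 * p - 2) + 1)) := by
      have : -((3 * p - 2) + 1) = 1 + (-(3 * p)) := by ring
      rw [this, Real.rpow_add hc, Real.rpow_one]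
    rw [hs, ← hpow]
    ring
  simp_rw [hfun]
  rw [key]
  field_simp

/-- `p = 1`: the `L¹`-integral of the lowest-weight coefficient is `2`. -/
theorem ruhl_measure_integral_one :
    ∫ η in Ioi (0 : ℝ), (1 / 2) * Real.sinh η * Real.cosh ((1 / 2) * η) ^ (-(3 * (1 : ℝ)))
      = 2 := by
  rw [ruhl_measure_integral 1 (by norm_num)]
  norm_num

/-- `p = 2`: the `L²`-integral of the lowest-weight coefficient is `1/2`
(the reciprocal of the formal degree `2k − 1 = 2` of Rühl's `(3/2, +)`). -/
theorem ruhl_measure_integral_two :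
    ∫ η in Ioi (0 : ℝ), (1 / 2) * Real.sinh η * Real.cosh ((1 / 2) * η) ^ (-(3 * (2 : ℝ)))
      = 1 / 2 := by
  rw [ruhl_measure_integral 2 (by norm_num)]
  norm_num

/-- **(N4.3.P1), the `ε`-bound (ref-2 N-T5N4.1′).** For `ε < 4`:
`∫₀^∞ cosh(t)^(ε−6) · sinh(2t) dt = 2/(4 − ε)`, in particular finite. -/
theorem epsilon_bound_integral (ε : ℝ) (hε : ε < 4) :
    ∫ t in Ioi (0 : ℝ), Real.cosh t ^ (ε - 6) * Real.sinh (2 * t) = 2 / (4 - ε) := by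
  have hr : 0 < 4 - ε := by linarith
  have key := integral_sinh_mul_cosh_rpow 1 (4 - ε) one_pos hr
  have hfun : ∀ t : ℝ, Real.cosh t ^ (ε - 6) * Real.sinh (2 * t)
      = 2 * (Real.sinh (1 * t) * Real.cosh (1 * t) ^ (-((4 - ε) + 1))) := by
    intro t
    have hc : 0 < Real.cosh t := Real.cosh_pos _
    have hpow : Real.cosh t * Real.cosh t ^ (ε - 6) = Real.cosh t ^ (-((4 - ε) + 1)) := by
      have : -((4 - ε) + 1) = 1 + (ε - 6) := by ring
      rw [this, Real.rpow_add hc, Real.rpow_one]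
    rw [Real.sinh_two_mul, one_mul, ← hpow]
    ring
  simp_rw [hfun]
  rw [integral_const_mul, key]
  field_simp

/-- The dominating integral of (N4.3.P1) is finite: the integrand is integrable on `(0, ∞)`
for `ε < 4`. -/
theorem epsilon_bound_integrable (ε : ℝ) (hε : ε < 4) :
    IntegrableOn (fun t : ℝ => Real.cosh t ^ (ε - 6) * Real.sinh (2 * t)) (Ioi (0 : ℝ)) := by
  have hr : 0 < 4 - ε := by linarith
  have hfun : (fun t : ℝ => Real.cosh t ^ (ε - 6) * Real.sinh (2 * t))
      = fun t => 2 * (Real.sinh (1 * t) * Real.cosh (1 * t) ^ (-((4 - ε) + 1))) := by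
    funext t
    have hc : 0 < Real.cosh t := Real.cosh_pos _
    have hpow : Real.cosh t * Real.cosh t ^ (ε - 6) = Real.cosh t ^ (-((4 - ε) + 1)) := by
      have : -((4 - ε) + 1) = 1 + (ε - 6) := by ring
      rw [this, Real.rpow_add hc, Real.rpow_one]
    rw [Real.sinh_two_mul, one_mul, ← hpow]
    ring
  rw [hfun]
  refine Integrable.const_mul ?_ 2
  have hcont : ContinuousWithinAt
      (fun t : ℝ => -(1 / (1 * (4 - ε))) * Real.cosh (1 * t) ^ (-(4 - ε))) (Ici (0 : ℝ)) 0 :=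
    (hasDerivAt_antideriv 1 (4 - ε) one_ne_zero hr.ne' 0).continuousAt.continuousWithinAt
  have hderiv : ∀ t ∈ Ioi (0 : ℝ),
      HasDerivAt (fun t : ℝ => -(1 / (1 * (4 - ε))) * Real.cosh (1 * t) ^ (-(4 - ε)))
        (Real.sinh (1 * t) * Real.cosh (1 * t) ^ (-((4 - ε) + 1))) t :=
    fun t _ => hasDerivAt_antideriv 1 (4 - ε) one_ne_zero hr.ne' t
  exact MeasureTheory.integrableOn_Ioi_deriv_of_nonneg hcont hderiv
    (integrand_nonneg 1 (4 - ε) one_pos) (tendsto_antideriv 1 (4 - ε) one_pos hr)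

end Summit.Ventures.HodgeRepro2.T5CoshIntegral
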